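import Literature.Barriers.RiemannHypothesis.BeurlingCounterexamples
import Literature.NumberTheory.BeurlingPrimes.HilberdinkLindelof
import Literature.NumberTheory.BeurlingPrimes.HilberdinkJumps
import HarnessLib

/-!
# Hilberdink's uncertainty principle `max{α, β} ≥ 1/2` (Hilberdink 2005, Theorem 1) — proof

Sibling proofs file of `Literature/Barriers/RiemannHypothesis/BeurlingCounterexamples.lean`, discharging
the named fact `Literature.Barriers.RiemannHypothesis.Hilberdink2005_thm1`: "Let `P` be an
`[α, β]`-system. Then `Θ = max{α, β} ≥ 1/2`" (T. W. Hilberdink, *Well-behaved Beurling primes and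
integers*, J. Number Theory 112 (2005) 332–344, Theorem 1).

## The proof (files `Literature/NumberTheory/BeurlingPrimes/Hilberdink*.lean`)

Suppose `max{α, β} < 1/2`; pick `θ ∈ (max{α, β}, 1/2)`, so that `|N_P(x) − ax| ≤ Cx^θ` and
`|ψ_P(x) − x| ≤ Cx^θ` on `[1, ∞)` for one constant `C` (the `ε`-clauses of `IsSystem`; the
"for no `ε < 0`" clauses are not used, exactly as in the paper). Then:
1. (*Counting, Mellin*, files I–II) `∑ λ_j^{−σ} < ∞` for `σ > 1`, `ζ_P(s) = s∫₁^∞ N_P x^{−s−1}`, and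
   `Z̃(s) = as + s(s−1)∫₁^∞ (N_P − ax)x^{−s−1}dx` continues `(s−1)ζ_P(s)` analytically to `Re s > θ`
   with `‖Z̃(s)‖ ≪ |s|²` (Hilberdink 2005 §1 / Hilberdink–Lapidus 2006 §2.1).
2. (*Log-derivative*, file III) likewise `F̃(s) = s + s(s−1)∫₁^∞(ψ_P − x)x^{−s−1}dx` continues
   `(s−1)(−ζ_P'/ζ_P)(s)`, via the Euler logarithm `L`, `ζ_P = e^L`, `L' = −∑ Λ n^{−s}`.
3. (*No zeros*, file IV = Hilberdink–Lapidus Thm 2.1) the relation `(s−1)Z̃' = Z̃(1 − F̃)` persists to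
   `Re s > θ` by the identity theorem and forbids zeros of `Z̃` there.
4. (*Zero order*, file V = Hilberdink–Lapidus Thm 2.3, "Theorem A") Borel–Carathéodory and Hadamard's
   three circles on `log Z` give `Z(σ+it) = O(|t|^ε)` for `σ > θ`, hence
   `‖∫₁^∞ E(x)x^{−σ₁−1+it}dx‖ ≤ K(1+|t|)^{ε−1}` on a line `θ < σ₁ < 1/2`.
5. (*The contradiction*, files VI–VII, replacing the truncated Perron formula and the mean-value bound
   `∫_{−T}^{T}|ζ_N(σ+it)|²dt ≥ k₁TN^{1−2σ} − k₂N^{2−2σ}` of Hilberdink 2005 §3 by their `L²`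
   counterpart) Mellin–Plancherel for `G_ρ(x) = ρ^{−σ₁}E(ρx) − E(x)`, `ρ = e^{c₀/X}`: the bound of
   step 4 gives `2π∫₀^∞‖G_ρ‖²x^{−2σ₁−1} ≪ X^{−2γ}` (`γ > σ₁`), while the unit jumps of `N_P` at the
   `≍ aX` generalized integers in `(2X, 3X]` give `≫ X^{−2σ₁}` — "plainly absurd if `Θ < 1/2`".

## Main results
* `Hilberdink2005_thm1_core` — no Beurling system has `|N_P(x) − ax| ≤ Cx^θ` and
  `|ψ_P(x) − x| ≤ Cx^θ` on `[1,∞)` with `a > 0`, `0 ≤ θ < 1/2`.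
* `Hilberdink2005_thm1_holds : Hilberdink2005_thm1`.

## References
* [Hilberdink2005] T. W. Hilberdink, *Well-behaved Beurling primes and integers*, J. Number Theory 112
  (2005) 332–344 (read: §§1–3, Theorem 1 and its proof, Theorem A, Remark C).
* T. W. Hilberdink, M. L. Lapidus, *Beurling zeta functions, generalised primes, and fractal membranes*,
  Acta Appl. Math. 94 (2006) 21–48, arXiv:math/0410270 (read: §2.1 Theorem 2.1, §2.3 Theorem 2.3 with
  proofs).
* T. W. Hilberdink, *A lower bound for the Lindelöf function associated to generalized integers*,
  J. Number Theory 122 (2007) 336–341 (read in full; the same mean-value mechanism).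
-/

noncomputable section

open Complex

namespace Literature.Barriers.RiemannHypothesis

open Literature.NumberTheory.BeurlingPrimes

/-- **Hilberdink 2005, Theorem 1 — core form.** No Beurling generalized prime system satisfies both
`|N_P(x) − ax| ≤ Cx^θ` and `|ψ_P(x) − x| ≤ Cx^θ` for all `x ≥ 1`, with `a > 0` and `0 ≤ θ < 1/2`.
[cite: Hilberdink2005, Theorem 1] -/
theorem Hilberdink2005_thm1_core {P : BeurlingPrimes} {a C θ : ℝ} (ha : 0 < a) (hθ0 : 0 ≤ θ)
    (hθ : θ < 1 / 2) (hN : ∀ x : ℝ, 1 ≤ x → |(P.intCount x : ℝ) - a * x| ≤ C * x ^ θ)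
    (hψ : ∀ x : ℝ, 1 ≤ x → |P.chebyshevPsi x - x| ≤ C * x ^ θ) : False := by
  -- a line `θ < σ₁ < 1/2` and an exponent `0 < ε` with `σ₁ + ε < 1/2`
  set σ₁ : ℝ := (θ + 1 / 2) / 2 with hσ₁
  have hθσ : θ < σ₁ := by rw [hσ₁]; linarith
  have hσhalf : σ₁ < 1 / 2 := by rw [hσ₁]; linarith
  set ε : ℝ := (1 / 2 - σ₁) / 2 with hεdef
  have hε : 0 < ε := by rw [hεdef]; linarith
  have hε1 : ε ≤ 1 := by rw [hεdef]; linarith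
  have hσε : σ₁ + ε < 1 / 2 := by rw [hεdef]; linarith
  -- Theorem A (zero order) ⟹ the Mellin transform of `E` decays on `Re = −σ₁`
  obtain ⟨K, hK⟩ := Hilberdink.exists_norm_mellin_errN_le ha hθ0 (by linarith) hN hψ hθσ
    (by linarith) hε hε1
  -- the `L²` contradiction
  exact Hilberdink.false_of_mellin_bound ha hN hθ0 hθσ hε hσε hK

/-- **Discharge of `Literature.Barriers.RiemannHypothesis.Hilberdink2005_thm1`** ("Let `P` be an
`[α, β]`-system. Then `max{α, β} ≥ 1/2`"): if `max{α, β} < 1/2`, take `θ` strictly between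
`max{α, β}` and `1/2`; the `ε`-clauses of `IsSystem` give `|N_P(x) − ax| ≤ C₁x^θ` and
`|ψ_P(x) − x| ≤ C₂x^θ` on `[1, ∞)`, contradicting `Hilberdink2005_thm1_core` with `C = max C₁ C₂`.
[cite: Hilberdink2005, Theorem 1] -/
theorem Hilberdink2005_thm1_holds : Hilberdink2005_thm1 := by
  intro P α β hsys
  by_contra hlt
  rw [not_le] at hlt
  obtain ⟨hα0, -, hβ0, -, a, ha, hNε, -, hψε, -⟩ := hsys
  have hαlt : α < 1 / 2 := lt_of_le_of_lt (le_max_left _ _) hlt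
  have hβlt : β < 1 / 2 := lt_of_le_of_lt (le_max_right _ _) hlt
  set θ : ℝ := (max α β + 1 / 2) / 2 with hθdef
  have hmθ : max α β < θ := by rw [hθdef]; linarith
  have hθ : θ < 1 / 2 := by rw [hθdef]; linarith
  have hαθ : α < θ := lt_of_le_of_lt (le_max_left _ _) hmθ
  have hβθ : β < θ := lt_of_le_of_lt (le_max_right _ _) hmθ
  have hθ0 : 0 ≤ θ := le_trans hα0 hαθ.le
  obtain ⟨C₁, hC₁⟩ : P.IntErrorLE a θ := by
    have h := hNε (θ - β) (by linarith)
    rwa [show β + (θ - β) = θ by ring] at h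
  obtain ⟨C₂, hC₂⟩ : P.PrimeErrorLE θ := by
    have h := hψε (θ - α) (by linarith)
    rwa [show α + (θ - α) = θ by ring] at h
  refine Hilberdink2005_thm1_core (P := P) (C := max C₁ C₂) ha hθ0 hθ (fun x hx ↦ ?_) (fun x hx ↦ ?_)
  · exact (hC₁ x hx).trans (mul_le_mul_of_nonneg_right (le_max_left _ _)
      (Real.rpow_nonneg (by linarith) _))
  · exact (hC₂ x hx).trans (mul_le_mul_of_nonneg_right (le_max_right _ _)
      (Real.rpow_nonneg (by linarith) _))

end Literature.Barriers.RiemannHypothesis
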